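/-
Origin: expansion seat `prover-pub-hodgecm-mc-binder-1-g17-0`, handover #R120r2 2026-08-20T22:31:33Z md5 ad6ff6583119 (81 l.; REPLACE of HodgeCM/Model/HsmallOfTowerAt.lean — PKG file now bb14f61bc9ce (85 l., incl. packager Origin header); body of record c7ef7b6fcbdf (81 l.) → ad6ff6583119; owner binder-1 #R120 (RUN 64); token strike only: hsmall_of_tower_at (hR) (hA) (R) … — no h₂; NAMES for audit: HodgeCM.Model.hsmall_of_tower_at) (`HOME/mc/pub-hodgecm-mc-binder-1-g17/campaign/new/HsmallOfTowerAt.lean`, md5 ad6ff6583119, 81 lines);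
landed by the gen-27 packager (p-g27) in gate run 65 REPLACES the earlier landed copy of `HodgeCM/Model/HsmallOfTowerAt.lean` (verbatim).
-/
/-
Copyright (c) 2026 the pub-hodgecm formalisation cell (harness21).  New file, not vendored.
Origin: session prover-pub-hodgecm-mc-binder-1-g17-0 (unit pub-hodgecm-mc-binder-1-g17, BINDER PROVER gen 17 of lineage mc-binder-1;
content lane (J-Liu-Θ), (J3) — E-shaped corollaries of the junction through the tower instance), 2026-08-20.
The theorem text below is ADOPTED VERBATIM from the E assembler's certified consumer draft
(`planner-pub-hodgecm-mc-glue-1-g11-0`, `mc/pub-hodgecm-mc-glue-1-g11/drafts-not-staged/run64/HodgeCM/Model/HsmallOfTowerAt.lean`,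
md5 8faf4c17d609, 2026-08-20T21:39Z), at the request of the row-9 custodian (axioms-1-g15) that the pointwise cut be binder-1's.
KERNEL ONLY: 1 theorem; 0 records, nothing cited, 0 Prop-valued definitions, MODEL-N ±0.
Nothing here is a claim of the manuscripts under adjudication.
-/
import Summits.HodgeConjecture.HodgeCM.Model.HsmallOfTower

noncomputable section

open Function Set
open NumberField
open Literature.AlgebraicGeometry.Motives
open Literature.AlgebraicGeometry.ShimuraVarieties
open Literature.AlgebraicGeometry.HodgeTheory
open Literature.NumberTheory.Automorphic
open Literature.NumberTheory.Automorphic.PicardCM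
open Literature.NumberTheory.Transcendental (Arapura2012_Cor_15_4_6)

namespace HodgeCM.Model

open HodgeCM.Model.TowerLevel HodgeCM.Model.TowerCarrier HodgeCM.Literature.Theta HodgeCM.Literature.Theta.LiuAlbaneseModuleDatum
open HodgeCM.CMTypeOps (inflate inflate_id)
open HodgeCM.Universe (ThetaModel)

variable (hHD : exists_isReal_hodgeModel) (hI : hodgePQ_independent_of_hodgeModel)
  (h₁ : BallQuotientUniformised) (h₃ : CMAbelianVarietyRealised)

/-!
# E's `hsmall` through the tower, POINTWISE in the theta model

`hsmall_of_tower` (#R116, `Model/HsmallOfTower.lean`) binds the theta model `R` once, outside `∀ {L ι₁}`.  E's theta model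
`thetaModelOf (orientBitι L ι₁) …` depends on the bound `(L, ι₁)`, so the E recipe needs the statement with `R`, `(L, ι₁)`, `V`,
`c`, `i` fixed in ONE call.  Same ingredients (`subset_span_of_tower` #R115, `span_iUnion_surfaceClasses_le_Uiso` #R83); no new
mathematics; no `P`-scope and no `[c.K:ℚ] = 6` premise are needed by the proof.
-/

/-- **E's `hsmall` THROUGH THE TOWER, POINTWISE.**  One theta model `R`, one `(L, ι₁, V, c, i)`: from the cited sentences for the
tower dictionary at `V`, a good context (`R.GoodCtx ι₁ c`) and a finite set `S` of characters carrying (J4) families of component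
classes for the theta classes `R.Theta V c i Γ` at the tower's levels, the `hsmall` clause of E at that point.  (binder-1's
`hsmall_of_tower` is this statement with `R` bound once outside `∀ {L ι₁}`; E needs `R := thetaModelOf (orientBitι L ι₁) …`
per point.) -/
theorem hsmall_of_tower_at (hR : DeligneMilne1982_Thm_6_20_full) (hA : Arapura2012_Cor_15_4_6)
    (R : (picardCMUniverse hHD hI h₁ h₃).ThetaModel)
    {L : CMField} {ι₁ : L →+* ℂ} (V : HermSpace3 L ι₁) (c : SeesawCtx L)
    (Char : Type) (Adm : Char → Type) (Ω : (μ : Char) → Adm μ → Type)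
    [∀ μ a, AddCommGroup (Ω μ a)] [∀ μ a, Module ℂ (Ω μ a)] [∀ μ a, Module (adelicAlgebra V) (Ω μ a)]
    [∀ μ a, IsScalarTower ℂ (adelicAlgebra V) (Ω μ a)] (PhiMu : Char → Prop) (adm : Char → LiuCMSide → Prop)
    (hcite : (LiuDictionary.ofTower hHD hI h₁ h₃ hA V Char Adm Ω PhiMu adm).Irreducible ∧
      (LiuDictionary.ofTower hHD hI h₁ h₃ hA V Char Adm Ω PhiMu adm).Prop413 ∧
      (LiuDictionary.ofTower hHD hI h₁ h₃ hA V Char Adm Ω PhiMu adm).Thm418_2 ∧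
      (LiuDictionary.ofTower hHD hI h₁ h₃ hA V Char Adm Ω PhiMu adm).MuSeparated ∧
      (LiuDictionary.ofTower hHD hI h₁ h₃ hA V Char Adm Ω PhiMu adm).Thm418C)
    (hgood : R.GoodCtx ι₁ c) (i : Fin 4)
    (hJ : ∃ S : Finset Char,
        (∀ μ ∈ S, PhiMu μ) ∧
        (∀ μ ∈ S, ∀ d : LiuCMSide, adm μ d → d.IsCorner c.K (c.Ψ i) c.σ) ∧
        ∀ (Γ : Level V) (hΓ : Γ.BelowConjThree), ∀ ω ∈ R.Theta V c i Γ,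
          ∃ cf : towerLevel hHD hI (ballQuotientUniformisedDatum_of h₁) h₃ hA Γ hΓ,
            TowerLevel.res hHD hI (ballQuotientUniformisedDatum_of h₁) h₃ hA cf = ω ∧
              (ofLevel hHD hI (ballQuotientUniformisedDatum_of h₁) h₃ hA Γ hΓ cf :
                  (LiuDictionary.ofTower hHD hI h₁ h₃ hA V Char Adm Ω PhiMu adm).H) ∈
                ⨆ μ ∈ S, (LiuDictionary.ofTower hHD hI h₁ h₃ hA V Char Adm Ω PhiMu adm).block μ) :
    ∃ Γ₀ : Level V, ∀ Γ ≤ Γ₀,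
      ∃ (M : CMField) (k : c.K →+* M) (σ' : M →+* ℂ), σ'.comp k = c.σ ∧
        R.Theta V c i Γ ⊆ (picardCMUniverse hHD hI h₁ h₃).Uiso Γ M (inflate k (c.Ψ i)) σ' := by
  obtain ⟨S, hΦ, hcorner, hfam⟩ := hJ
  obtain ⟨hirr, h413, h4182, hμ, h418⟩ := hcite
  obtain ⟨Γ₀, hΓ₀⟩ := subset_span_of_tower (hHD := hHD) (hI := hI) (h₁ := h₁) (h₃ := h₃) hA Char Adm Ω PhiMu adm
    hirr h413 h4182 hμ h418 S hΦ hcorner (fun Γ ↦ R.Theta V c i Γ) hfam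
  refine ⟨Γ₀, fun Γ hΓ ↦ ⟨c.K, RingHom.id _, c.σ, RingHom.comp_id _, ?_⟩⟩
  rw [inflate_id]
  exact fun x hx ↦ span_iUnion_surfaceClasses_le_Uiso hHD hI h₁ h₃ hR V Γ (hgood.mem i) (hΓ₀ Γ hΓ hx)

end HodgeCM.Model

end
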